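import Summits.HodgeConjecture.HodgeConjecture.Theorems.F0D9opRoad2BodyLetters   -- ★ previous part of the same Lines workfile `F0D9opRoad2Body` (size-lint split ×4)
import HarnessLib

/-!
# `F0D9opRoad2BodyDesk` — ★ RE-HOME of `Lines/F0D9opRoad2Body.lean`, PART 2 of 4 (size-lint split; cut at a declaration boundary).

See PART 1 `Theorems/F0D9opRoad2BodyLetters.lean` for the full re-home header and the original module docstring (verbatim there). Namespaces and sections KEPT
(re-opened below exactly as they stand at the cut, with their `open`∕`variable` lines replayed); code bytes = the workfile՚s, docstrings included; options preamble repeated from PART 1.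
HC_CM is proved only modulo the 7 printed citations (2 remaining: hLiu418 = stmt-HodgeConjecture-24832, h413 = stmt-HodgeConjecture-24833) until rung 0 closes; a re-home is count-neutral. -/

namespace Summit.HodgeConjecture.HodgeConjecture.Cruxes.HLiu418.F0D9opRoad2
set_option linter.dupNamespace false  -- `Summit.HodgeConjecture.HodgeConjecture.…` BY DESIGN (D-0017), as in `Lines/d6_cm_curve.lean`
open CategoryTheory NumberField IsDedekindDomain MulAction
open scoped Matrix MonObj CategoryTheory.Obj
open MonoidalCategory
open Summit.HodgeConjecture.CorCM.Lines.A3Liu418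
open Literature.AlgebraicGeometry.Motives (AbelianVariety)
open Literature.AlgebraicGeometry.Motives.AbelianVariety (rationalTateModuleMap frobeniusHom zsmul_eq_zsmul_trace_comp_of_pin
  exists_finite_forall_exists_goodReductionAt_homReduction_tateSpecialisation)
open Literature.NumberTheory.GaloisRepresentations
open Literature.NumberTheory.Automorphic Literature.NumberTheory.Automorphic.UnitaryGroup
open Literature.AlgebraicGeometry.ShimuraVarieties.UnitaryCanonicalModel
open Literature.NumberTheory.Automorphic.Liu2021.AppendixC
open Literature.AlgebraicGeometry.Motives (AlgPoints IntegralModel frobeniusOver SchemeOver)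
open Literature.NumberTheory.DiophantineGeometry (geomResidueField)


/-! ### Edition 4 (skeleton): the pole `stub_C` cut into the BOUNDARY letter C3 (Albanese-free congruence on points), C1b (trace), H (surjective
reduction) and three generic∕record supports (U, π0, Fr) — director s366 R1, F0P5a-plan ED4-CUT-LETTER v0 §§4–8, F0P5a-p02 (g0) design of record
23:16Z + hand-back memo `F0/P5a/ED4-PEN-HANDBACK.v0.F0P5a-p02g0.md` f04970c8 (letters below = its §1 VERBATIM).  The composition `stub_C_of` is the
pen՚s (A-p03 (g16), LEAD WORD #8); THIS SKELETON fixes the six letter statements so that closers can target them tonight. -/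

/-- **LETTER H (consumed form) — `ProperFlatModelReductionSurjective`** (F0P5a-plan (g0) desk 83396000 verbatim): for every number field `K`, finite
place `v`, `K`-scheme `X` and PROPER FLAT integral model `𝒳` of `X` over `𝓞_{K,(v)}`, the reduction map `red_𝒳 : X(\overline{K_v}) → 𝒳_v(κ̄(v))`
(★ p793383 `IntegralModel.geomReductionMap`) is surjective.  Consumed at `𝒳 := 𝒮 ⊗ 𝒮` (smooth ⇒ flat; ★ p794609
`IntegralModel.geomReductionMap_tensor_surjective`).  Closers: road (a) smooth + henselian ([BoschLutkebohmertRaynaud1990] §2.3 Prop. 5), road (b)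
flat-proper going-down ([Liu2002] Prop. 10.1.36, Cor. 10.1.38; F0P5a-p01 (g0) ★ p794118 + A-p03 (g16)).  NOT asserted here: `stub_H`.
(print: Liu2002, Prop. 10.1.36 and Cor. 10.1.38 (p. 468–469)) (print: SerreTate1968, §1 (the reduction map)) -/
def ProperFlatModelReductionSurjective : Prop :=
  ∀ (K : Type) [Field K] [NumberField K] (v : HeightOneSpectrum (𝓞 K)) (X : Literature.AlgebraicGeometry.Motives.SchemeOver K)
    (𝒳 : Literature.AlgebraicGeometry.Motives.IntegralModel (HeightOneSpectrum.valuationSubringAtPrime K v) K X)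
    [AlgebraicGeometry.IsProper 𝒳.total.hom] [AlgebraicGeometry.Flat 𝒳.total.hom],
    Function.Surjective 𝒳.geomReductionMap

/-- **`stub_H : ProperFlatModelReductionSurjective` — DISCHARGED** by ★ p796981 `properFlatModelReductionSurjective` (F0P5a-p03 (g0), road (b): flat-proper
going-down ★ p794118 + place-from-embedding ★ p794503 + the κ̄-twist over ★ p796243 (A-p03 (g16)) and ★ p796419; the letter token for token).
[cite: Liu2002, Prop. 10.1.36 and Cor. 10.1.38 (p. 468–469)] -/
theorem stub_H : ProperFlatModelReductionSurjective :=
  fun K _ _ v X 𝒳 _ _ => Literature.AlgebraicGeometry.Motives.properFlatModelReductionSurjective K v X 𝒳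

/-- **LETTER C3 — `RecordCurveCongruenceOnPoints`** (F0P5a-plan (g0) C3 desk; ED4-CUT-LETTER v0 §3 + §7; director s366 R1: the BOUNDARY
statement of D9op road 2′, a registered STUB of the line, never a consumed hypothesis).  The Eichler–Shimura CONGRUENCE RELATION of the
record unitary Shimura CURVE `M⋆` read on POINTS — Albanese-free, Néron-free, pin-free: for every record datum and small level `K` there is a
finite set `S₃(K)` of places such that at every place `w ∉ S₃(K)` of `F` split over `F⁺` (`c • w ≠ w`), with `J⋆_w ∈ GL₂(𝒪_w)` and `K`
hyperspecial at `w|_{F⁺}`, there EXISTS a smooth proper model `𝒮` of `M⋆_K` over `𝒪_{F,(w)}` ([Liu2021] D.8 (1)) such that for every small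
`N ⊆ K` at which the Hecke translates `T_{r} : M⋆_N → M⋆_K` of the coset representatives `r₁ α` of `K t₁ K ∕ K` (`t₁ = heckeElementAt … 1`,
the `T_𝔭`-double coset) and `r₂ α` of `K t₂ K ∕ K` (`t₂ = heckeElementAt … 2`, central: `⟨ϖ⟩`) are defined, and for EVERY geometric point
`x ∈ M⋆_N(Ω)`, `Ω = \overline{F_w}`, the following identity of finite multisets of `κ̄(w)`-points of the special fibre `𝒮_w` holds:
  `{F (red_𝒮 (T_{r₁ α} x))}_α = {F (F (red_𝒮 (u x)))} + (N w) • {red_𝒮 (T_{r₂ α} x)}_α`,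
`u = u^N_K : M⋆_N → M⋆_K` the transition map, `red_𝒮 : M⋆_K(Ω) → 𝒮_w(κ̄(w))` the reduction map of the PROPER model (★∕🚀 p793383
`IntegralModel.geomReductionMap`, F0P5a-p02), `F` the `q`-Frobenius of `𝒮_w` on points (★ `frobeniusOver`).  Since `{T_{r₁ α} x}_α` is the
Hecke correspondence `T_𝔭(u x)` as a 0-cycle and `T_{r₂ α} x = ⟨ϖ⟩(u x)`, this is print՚s «`T̄_𝔭(x̄) = F x̄ + q·⟨ϖ⟩F⁻¹ x̄` as 0-cycles on the
special fibre» with `F` applied once more to clear `F⁻¹` ([Liu2021] p. 139 L4–L10 with Prop. D.8 (2)(3); [DiamondShurman2005] Thm. 8.7.2;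
[Shimura1971] (7.4.1)–(7.4.3); [Carayol1986Compositio] §10.3).  Phrased at level `N` on `Ω`-points so that neither an integral extension of `⟨ϖ⟩` nor the
level-quotient action nor any Albanese∕trace appears; `∃ 𝒮` so that the MODULAR model (MOD, director s366 R2) plugs in.  HOW IT IS CONSUMED
(ED4 §4): with H (surjectivity of `red` on `𝒮 ⊗ 𝒮`), C2 (`red` commutes with model morphisms, ★∕🚀 `IntegralModel.geomReductionMap_map`), C1 (the
honest correspondence `𝒯ᵢ = t ≫ Σ_α Alb(T_{rᵢ α})` through `α_K` on `∇_N`, ★ C1a `Albanese.exists_trace_of_isSepQuotient` + ★ p793039) and the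
pairing-independence of `Σ_α ᾱ(a_α, b_α)` (Bk3) it yields `stub_C : RecordCurveEichlerShimuraPointwise`.  EVERY printed proof of this statement
uses a modular (PEL) description of `𝒮_w` (F0P5a-p02 S-e memo 3a115d8e, K1).  NOT asserted here.
(print: Liu2021, Prop. D.8 (1)–(3) and Cor. D.9 proof (FJcycle.tex l. 5579–5600; print pp. 135–139)) (print: DiamondShurman2005, Thm. 8.7.2 (p. 353))
(print: Shimura1971, §7.4 (7.4.1)–(7.4.3)) (print: Carayol1986Compositio, §10.3 p. 210) -/
def RecordCurveCongruenceOnPoints : Prop :=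
  ∀ (F : Type) [Field F] [NumberField F] [IsCMField F] [IsGalois ℚ F] (ι₁ : F →+* ℂ)
    (Jstar : Matrix (Fin 2) (Fin 2) F)
    (K₀ : C5.OpenCompactSubgroup ↥(finAdelic ↥(maximalRealSubfield F) F (IsCMField.complexConj F) 2 Jstar))
    (S : RecordSystemGS F Jstar ι₁ K₀) (hU7ₛ : S.HeckeTranslateDefinedOver)
    (hJ : (Jstar.map (IsCMField.complexConj F))ᵀ = Jstar) (hJu : IsUnit Jstar) (K : C5.SmallLevel K₀),
    ∃ S₃ : Set (HeightOneSpectrum (𝓞 F)), S₃.Finite ∧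
      ∀ w : HeightOneSpectrum (𝓞 F), w ∉ S₃ → ∀ hw : (IsCMField.complexConj F) • w ≠ w,
        (UnitaryGroup.isUnit_placeForm Jstar hJu w).unit ∈ glInt 2 (w.adicCompletion F) →
          UnitaryGroup.IsHyperspecialAt ↥(maximalRealSubfield F) F (IsCMField.complexConj F) 2 Jstar K.1.1
            (w.under (𝓞 ↥(maximalRealSubfield F))) →
          ∃ (𝒮 : IntegralModel (HeightOneSpectrum.valuationSubringAtPrime F w) F (S.M.obj K)) (h𝒮 : 𝒮.IsSmoothProper 1),
           haveI : AlgebraicGeometry.IsProper 𝒮.total.hom := h𝒮.2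
           ∀ (N : C5.SmallLevel K₀) (hNK : N ≤ K)
             (r₁ : orbit (K.1.1 : Subgroup ↥(finAdelic ↥(maximalRealSubfield F) F (IsCMField.complexConj F) 2 Jstar))
                  ((UnitaryGroup.heckeElementAt ↥(maximalRealSubfield F) F (IsCMField.complexConj F) 2 Jstar
                      (⟨w, rfl⟩ : UnitaryGroup.PlacesOver F (w.under (𝓞 ↥(maximalRealSubfield F))))
                      (IsCMField.complexConj_ne_one F) hJ hw (UnitaryGroup.isUnit_placeForm Jstar hJu w) (HeckeCharacter.uniformizer F w) 1 :
                    ↥(finAdelic ↥(maximalRealSubfield F) F (IsCMField.complexConj F) 2 Jstar)) :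
                    ↥(finAdelic ↥(maximalRealSubfield F) F (IsCMField.complexConj F) 2 Jstar) ⧸
                      (K.1.1 : Subgroup ↥(finAdelic ↥(maximalRealSubfield F) F (IsCMField.complexConj F) 2 Jstar))) →
                ↥(finAdelic ↥(maximalRealSubfield F) F (IsCMField.complexConj F) 2 Jstar)),
             (∀ α, ((r₁ α : ↥(finAdelic ↥(maximalRealSubfield F) F (IsCMField.complexConj F) 2 Jstar)) :
                 ↥(finAdelic ↥(maximalRealSubfield F) F (IsCMField.complexConj F) 2 Jstar) ⧸
                   (K.1.1 : Subgroup ↥(finAdelic ↥(maximalRealSubfield F) F (IsCMField.complexConj F) 2 Jstar))) = α.1) →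
             ∀ (hrN₁ : ∀ α, C5.HeckeLE (r₁ α) N K)
               (r₂ : orbit (K.1.1 : Subgroup ↥(finAdelic ↥(maximalRealSubfield F) F (IsCMField.complexConj F) 2 Jstar))
                  ((UnitaryGroup.heckeElementAt ↥(maximalRealSubfield F) F (IsCMField.complexConj F) 2 Jstar
                      (⟨w, rfl⟩ : UnitaryGroup.PlacesOver F (w.under (𝓞 ↥(maximalRealSubfield F))))
                      (IsCMField.complexConj_ne_one F) hJ hw (UnitaryGroup.isUnit_placeForm Jstar hJu w) (HeckeCharacter.uniformizer F w) 2 :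
                    ↥(finAdelic ↥(maximalRealSubfield F) F (IsCMField.complexConj F) 2 Jstar)) :
                    ↥(finAdelic ↥(maximalRealSubfield F) F (IsCMField.complexConj F) 2 Jstar) ⧸
                      (K.1.1 : Subgroup ↥(finAdelic ↥(maximalRealSubfield F) F (IsCMField.complexConj F) 2 Jstar))) →
                ↥(finAdelic ↥(maximalRealSubfield F) F (IsCMField.complexConj F) 2 Jstar)),
             (∀ α, ((r₂ α : ↥(finAdelic ↥(maximalRealSubfield F) F (IsCMField.complexConj F) 2 Jstar)) :
                 ↥(finAdelic ↥(maximalRealSubfield F) F (IsCMField.complexConj F) 2 Jstar) ⧸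
                   (K.1.1 : Subgroup ↥(finAdelic ↥(maximalRealSubfield F) F (IsCMField.complexConj F) 2 Jstar))) = α.1) →
             ∀ (hrN₂ : ∀ α, C5.HeckeLE (r₂ α) N K),
             ∀ x : AlgPoints (S.M.obj N) (AlgebraicClosure (w.adicCompletion F)),
               ∑ᶠ α, ({AlgPoints.map (frobeniusOver 𝒮.reductionAt)
                          (𝒮.geomReductionMap (AlgPoints.map (recordHeckeTranslateGS S hU7ₛ (r₁ α) N K (hrN₁ α)) x))} :
                        Multiset (AlgPoints 𝒮.reductionAt (geomResidueField w)))
                 = {AlgPoints.map (frobeniusOver 𝒮.reductionAt) (AlgPoints.map (frobeniusOver 𝒮.reductionAt)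
                       (𝒮.geomReductionMap (AlgPoints.map (S.M.map (homOfLE hNK)) x)))}
                   + ∑ᶠ α, Ideal.absNorm w.asIdeal •
                       ({𝒮.geomReductionMap (AlgPoints.map (recordHeckeTranslateGS S hU7ₛ (r₂ α) N K (hrN₂ α)) x)} :
                         Multiset (AlgPoints 𝒮.reductionAt (geomResidueField w)))

/-- **LETTER D.8 — `letter_D8_heckeReductionPointwise`** (director s392 (1) ∕ s396 (1): the ONE open printed letter of P5a at FLOOR 0 —
the congruence relation of the record unitary Shimura curve read on points, PINNED to `𝒪_{F,(w)}` (s396 (1)); discharging it is the MOD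
programme «P6 — `p`-adic integral models» (MOD-PLAN v0.1, rows 1–6), not this line).  It IS `RecordCurveCongruenceOnPoints`: the consumption
shape of C3 is already the pointwise reading of D.8 (1)–(3) with p. 139 L4–L10, so NO second statement and NO bridge file are introduced
(`stub_C_of` consumes `stub_C3` by `abbrev` unfolding).  The model `𝒮` is EXISTENTIALLY bound on purpose: smooth proper models of genus-0
components are not unique as models, so «for every abstract smooth proper model (T1)» would be a different — and unsafe — letter.
(print: Liu2021, Prop. D.8 (1)–(3) + proof of Cor. D.9 p. 139; Carayol1986Compositio, Prop. 10.3) -/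
abbrev letter_D8_heckeReductionPointwise : Prop := RecordCurveCongruenceOnPoints

/-! ### EDITION 5 — DESK v0 (F0P5a-plan (g3), 2026-08-31; HOME DESK ONLY until the human՚s P6 word — director s392 (3) ∕ s422 (b) ∕ s430 (4);
NOT registered, NOT `crux write`-n, NOT `skeleton check`-ed): the RECORD BRIDGE from the MOD boundary to `letter_D8_heckeReductionPointwise`
(ROAD L-B′ «cofinal full-fibre levels + record descent», F0P5a-plan (g3) ruling 03:21:04Z)

`stub_C3` becomes a DEFINITION `stub_C3_of stub_MOD stub_Q stub_deg stub_desc` over FOUR letters and ONE pen body: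
* `stub_MOD : RecordCurveCongruenceCorrespondenceCofinal` — THE NEW BOUNDARY (XL; the P6∕MOD programme «`p`-adic integral models», MOD-PLAN v0.6
  Rows 1–6 + L5.4; nothing else of P5a depends on it): [Liu2021] Prop. D.8 (1)–(3) in TWO-SECTION form (F0P5a-plan (g2) desk
  `Gamma3-RECORD-DESK.v0` ecc63e1c :51, body verbatim) delivered at a COFINAL `w`-hyperspecial sublevel `Kc ≤ K` where the level-lowering
  map `u′ : M⋆_{K₁} → M⋆_{Kc}` (`K₁ = Kc ∩ t₁ Kc t₁⁻¹`) has FULL geometric fibres (clause (7): `N w + 1` points over every `Ω`-point —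
  print: at neat level the forgetful maps of PEL moduli are finite étale) [since ED. 5.1∕5.2: LETTER FULL `RecordNeatLevelFullFibres`, not a MOD clause — E1], together with a model morphism `ū : 𝒮c ⟶ 𝒮` over `u_{Kc→K}` onto a
  smooth proper model `𝒮` of `M⋆_K` (MOD builds `𝒮` as the tame quotient `𝒮c ∕ (K∕Kc)`: ★ L6.6 `GeometricQuotientTameSmoothCurve`,
  `IntegralModelOfFiniteQuotient`);
* `stub_Q : HeckeSumReindexing` — record: the `α`-indexed Hecke translates are the `T_{t₁}`-images of the `u′`-fibre (F0P5a-plan (g2) letter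
  ecc63e1c :115 verbatim; INHABITED on the HOME desk `Gamma3Q-PROOF-DESK.v0.F0P5a-p05g3.lean` 263db0a2, REF1-countersigned re-homed leg
  2a13d569 rc 0 — paste source at registration; L);
* `stub_deg : HeckeDegreeSplitPlace` — generic adelic group theory at a split hyperspecial place: `#(K t₁ K ∕ K) = N w + 1`, `K t₂ K = t₂ K`,
  `t₂` normalises `K` (F0P5a-p04 (g3) row (b4) `Literature/NumberTheory/Automorphic/UnitaryGroupHeckeDegreeSplitPlace.lean`, fileable ★ capital; M);
* `stub_desc : HeckeMultisetLevelDescent` — record: the level-`K` Hecke translates of `x ∈ M⋆_N(Ω)` are the `u_{Kc→K}`-images of level-`Kc`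
  Hecke translates of a lift `x′` of `x` to a deeper level, along a bijection of coset spaces `K tᵢ K ∕ K ≃ Kc tᵢ Kc ∕ Kc` (F0P5a-p05 (g3) row (b5)
  HOME desk; the coset bijection is generic = F0P5a-p02 (g3) row (b6) `UnitaryGroupHeckeCosetLevelChange.lean`, fileable; M);
* `stub_C3_of` — the PEN (F0P5a-p01 (g4) rows (b1) CORE-SET + (b1′) PEN, HOME desks; M): at `(K, w)` take MOD՚s `S₃` and `𝒮`; at
  `(N, r₁, r₂, x)` descend to `(Kc, N′, r̃₁, r̃₂, x′)` by `stub_desc`; at level `Kc` the Γ3-Q lift is surjective (`stub_Q`) between finite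
  types of the same cardinality `N w + 1` (`stub_deg` at `Kc` + clause (7)) hence BIJECTIVE; the pointwise two-section identity ★ Γ3-A′
  `IntegralModel.finsum_smul_geomReductionMap_map_eq_of_two_sections` (p801437) + ★ `ncard_fibre_geomReductionMap_eq_one_of_isOpenImmersion_specialFibre`
  (p805580 §3) gives C3 at `(Kc, 𝒮c, N′, r̃₁, r̃₂, x′)`; push forward along `ū_v` (★ C2a `IntegralModel.geomReductionMap_map`, ★
  `AlgPoints.map_frobeniusOver_map`) and reindex by the coset bijections.
WHY L-B′ AND NOT THE LEVEL-UNIFORM ROAD: at a non-neat `K` the `u′`-fibre over an elliptic point has fewer than `N w + 1` points and the Γ3-Q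
lift is not injective; repairing that pointwise needs the record fact «elements of `K∕N′` acting trivially on a component of `M⋆_{N′,Ω}` lie in
`K₁∕N′`», which the `RecordSystemGS` axioms do not visibly give.  L-B′ gets injectivity by COUNTING at full-fibre levels and descends, using only
the `w`-factorisation inside `IsHyperspecialAt`, ★ `IsSepQuotient.surjective_map_geometric_of_finiteIndex` (p805003) and the record Hecke laws.
SORRY LEDGER of this desk: 5 (`stub_MOD`, `stub_Q`, `stub_deg`, `stub_desc`, `stub_C3_of`); as the HOME desks∕★ files land they are pasted∕cited
here and the line՚s ONE residual sorry becomes `stub_MOD` = the MOD boundary in print shape.  If the human՚s P6 word is NO, nothing changes in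
the tree: ED. 4 (one sorry `stub_C3`) stays the line of record and this desk is the dossier.
HC_CM is proved only modulo the 7 printed citations until rung 0 closes. -/

section Edition5Desk

open Literature.NumberTheory.EllipticCurves (genericFibre)
open Literature.NumberTheory.DiophantineGeometry (specialFibreFunctor)
open IsLocalRing (closedPoint)

/-- **ED. 5.2 LETTER FULL — `RecordNeatLevelFullFibres`** (F0P5a-plan (g3), 2026-08-31; was clause (7) of the MOD letter in desk v0∕v0.1;
moved to the RECORD side on A-p07 (g17) 04:08:10Z «(7) lives on the generic fibre, needs no integral model, is decision-independent»;
HYPOTHESIS-FREE since 5.2 on REF1 OBJECTION #2 04:23:58Z: every small level `K : C5.SmallLevel K₀` is torsion-free through the record՚s own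
clause (F2c) `RecordSystemGS.pieces` — the disc-quotient data `B q : UnitaryBallUniformisationDatum 1 (X q)` carry `torsionFree` and
`posDef_of_ne`, and ★ `UnitaryConeDiscontinuity` §5 `UnitaryBallUniformisationDatum.eq_one_of_act_eq_smul` is line-freeness):
every fibre of the level change `u′ : M⋆_{K₁}(Ω) → M⋆_{Kc}(Ω)` (`K₁ ≤ Kc` small levels, `Ω = F̄_w`, any `w`) is FULL — it has exactly
`[Kc : K₁]` points.  Proof plan (record currency, HOME desk, row (b12) «NEAT-FREE», F0P5a-p02 (g3), A-p07 consultant): `Kc ∕ N′` acts FREELY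
on `Sh_{N′}(ℂ)` (★ `ShimuraSetGS.mk_eq_mk_iff`: a fixed point `[v, a k] = [v, a]` gives a rational `γ` with `γ^τ v = c • v` and `a⁻¹γa ∈ Kc`;
write `a = γ′ g_q k′` by the surjectivity clause of `pieces`, so `γ′⁻¹γγ′` lies in the level `Γ(g_q Kc g_q⁻¹) = (B q).Γ` and fixes the line
of `γ′⁻¹ v` ⇒ `= 1` by `eq_one_of_act_eq_smul` ⇒ `k ∈ N′`); freeness transports to `Ω`-points along ONE `F`-algebra map `Ω → ℂ` over `ι₁`
(★ `HodgeTheory/ComplexPointsLifting` + automorphism extension; `AlgPoints.map` is equivariant) through `pts`∕`map_pts`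
(★ `UnitaryShimuraCurveLevelFibres` §2 `map_complexPoints_eq_iff`); then the fibre over a free `Kc∕N′`-orbit is the set of its `K₁∕N′`-orbits,
of cardinal `[Kc : K₁]` (F0P5a-p02 (g3) rf `SepQuotientIntermediateFibreMultiplicity` 54b4ed13 `natCard_setOf_map_eq_eq_index_of_stabilizer_le_normal`
over ★ p805003 ∕ ★ p807651 §5).  M; NOT asserted here.
(print: Milne2005ShimuraVarieties, Prop. 3.1 (b), §5 Lemma 5.13, Rem. 5.29 (c) p. 65, Thm. 13.6) (print: Deligne1979ShimuraVarieties, 2.1.2–2.1.4, 2.7.1)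
(print: Pink1990Compactification, 0.6, 3.3) -/
def RecordNeatLevelFullFibres : Prop :=
  ∀ (F : Type) [Field F] [NumberField F] [IsCMField F] [IsGalois ℚ F] (ι₁ : F →+* ℂ)
    (Jstar : Matrix (Fin 2) (Fin 2) F)
    (K₀ : C5.OpenCompactSubgroup ↥(finAdelic ↥(maximalRealSubfield F) F (IsCMField.complexConj F) 2 Jstar))
    (S : RecordSystemGS F Jstar ι₁ K₀)
    (_hJ : (Jstar.map (IsCMField.complexConj F))ᵀ = Jstar) (_hJu : IsUnit Jstar)
    (Kc K₁ : C5.SmallLevel K₀) (hle : K₁ ≤ Kc)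
    (w : HeightOneSpectrum (𝓞 F)) (z : AlgPoints (S.M.obj Kc) (AlgebraicClosure (w.adicCompletion F))),
    Nat.card {y : AlgPoints (S.M.obj K₁) (AlgebraicClosure (w.adicCompletion F)) //
        AlgPoints.map (S.M.map (homOfLE hle)) y = z}
      = (K₁.1.1 : Subgroup ↥(finAdelic ↥(maximalRealSubfield F) F (IsCMField.complexConj F) 2 Jstar)).relIndex Kc.1.1

/-- **LETTER MOD — `RecordCurveCongruenceCorrespondenceCofinal`** (ED. 5 boundary; [Liu2021] Prop. D.8 (1)–(3) in two-section form at a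
cofinal full-fibre level).  For every record datum and small level `K` there is a finite set `S₃(K)` of places such that at every split
place `w ∉ S₃(K)` with `J⋆_w ∈ GL₂(𝒪_w)` and `K` hyperspecial-factorisable at `w|_{F⁺}` MOD supplies: a smooth proper model `𝒮` of `M⋆_K`
over `𝒪_{F,(w)}` (the pin of s396 (1)); a sublevel `Kc ≤ K`, again hyperspecial-factorisable at `w|_{F⁺}` (print: `Kc = K ∩ K(𝔩^m)` for an
auxiliary prime `𝔩 ∤ w` making `Kc` neat); a smooth proper model `𝒮c` of `M⋆_{Kc}` with a model morphism `ū : 𝒮c ⟶ 𝒮` whose generic fibre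
is the transition map `u_{Kc→K}` (★ C2a square); and, for the (unique) small level `K₁ = Kc ∩ t₁ Kc t₁⁻¹` (binders `hle`, `ht`, `_hK₁`;
`t₁ = heckeElementAt … 1`, `t₂ = heckeElementAt … 2` as in C3, `ht₂ : t₂⁻¹ Kc t₂ ⊆ Kc`): (clause (7) FULL FIBRES is no longer part of this letter:
moved to LETTER FULL `RecordNeatLevelFullFibres`, ED. 5.1∕5.2 — erratum E1, F0P5a-ref1 (g6) 2026-09-01);
and the TWO-SECTION DATUM of F0P5a-plan (g2)՚s desk letter `RecordCurveCongruenceCorrespondence` (ecc63e1c :51) VERBATIM at `(Kc, 𝒮c)`: a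
proper model `𝒯` of `M⋆_{K₁}`, `π₁ π₂ : 𝒯 ⟶ 𝒮c` with generic fibres `u′` and `T_{t₁}`, `π₁` flat ∕ lfp ∕ finite, maps `s s′` on
`κ̄(w)`-points of the special fibres exhausting the `π₁ᵥ`-fibres (1), both sections of `π₁ᵥ` (2)(3), an open `V ⊆ 𝒯ᵥ` on which `π₁ᵥ` is an
open immersion containing `s ȳ` whenever `s ȳ ≠ s′ ȳ` (4) (D.8 (3)(a): `π⁺` is an isomorphism — `T⁺` read off `T⁻`), `π₂ᵥ ∘ s = Frob_q` (5)
(D.8 (3)(d): `(π⁻)(t ⊗ σ)(π⁺)⁻¹ = Frob`), and `Frob_q ∘ π₂ᵥ ∘ s′ ∘ red = red ∘ T_{t₂}` on `M⋆_{Kc}(Ω)` (6) (`⟨ϖ⟩`, without positing an integral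
extension of `T_{t₂}`).  XL; discharged only by the MOD programme P6 (MOD-PLAN v0.6 Rows 1–6, L5.4 + L6.4–L6.6).  NOT asserted here.
(print: Liu2021, Prop. D.8 (1)–(3) p. 135 and proof of Cor. D.9 p. 139 L4–L10) (print: Carayol1986Compositio, §§6.6–6.7, §9.4, Prop. 10.3)
(print: DiamondShurman2005, Thm. 8.7.2) (print: KatzMazur1985, Thm. 13.4.7) -/
def RecordCurveCongruenceCorrespondenceCofinal : Prop :=
  ∀ (F : Type) [Field F] [NumberField F] [IsCMField F] [IsGalois ℚ F] (ι₁ : F →+* ℂ)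
    (Jstar : Matrix (Fin 2) (Fin 2) F)
    (K₀ : C5.OpenCompactSubgroup ↥(finAdelic ↥(maximalRealSubfield F) F (IsCMField.complexConj F) 2 Jstar))
    (S : RecordSystemGS F Jstar ι₁ K₀) (hU7ₛ : S.HeckeTranslateDefinedOver)
    (hJ : (Jstar.map (IsCMField.complexConj F))ᵀ = Jstar) (hJu : IsUnit Jstar) (K : C5.SmallLevel K₀),
    ∃ S₃ : Set (HeightOneSpectrum (𝓞 F)), S₃.Finite ∧
      ∀ w : HeightOneSpectrum (𝓞 F), w ∉ S₃ → ∀ hw : (IsCMField.complexConj F) • w ≠ w,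
        (UnitaryGroup.isUnit_placeForm Jstar hJu w).unit ∈ glInt 2 (w.adicCompletion F) →
          UnitaryGroup.IsHyperspecialAt ↥(maximalRealSubfield F) F (IsCMField.complexConj F) 2 Jstar K.1.1
            (w.under (𝓞 ↥(maximalRealSubfield F))) →
          ∃ (𝒮 : IntegralModel (HeightOneSpectrum.valuationSubringAtPrime F w) F (S.M.obj K)) (_h𝒮 : 𝒮.IsSmoothProper 1)
            (Kc : C5.SmallLevel K₀) (hKcK : Kc ≤ K)
            (_hKc : UnitaryGroup.IsHyperspecialAt ↥(maximalRealSubfield F) F (IsCMField.complexConj F) 2 Jstar Kc.1.1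
               (w.under (𝓞 ↥(maximalRealSubfield F))))
            (𝒮c : IntegralModel (HeightOneSpectrum.valuationSubringAtPrime F w) F (S.M.obj Kc)) (h𝒮c : 𝒮c.IsSmoothProper 1)
            (ū : 𝒮c.total ⟶ 𝒮.total)
            (_hū : (genericFibre (HeightOneSpectrum.valuationSubringAtPrime F w) F).map ū ≫ 𝒮.genericIso'.hom
               = 𝒮c.genericIso'.hom ≫ S.M.map (homOfLE hKcK)),
           haveI : AlgebraicGeometry.IsProper 𝒮c.total.hom := h𝒮c.2
           ∀ (K₁ : C5.SmallLevel K₀) (hle : K₁ ≤ Kc)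
             (ht : C5.HeckeLE
                (UnitaryGroup.heckeElementAt ↥(maximalRealSubfield F) F (IsCMField.complexConj F) 2 Jstar
                    (⟨w, rfl⟩ : UnitaryGroup.PlacesOver F (w.under (𝓞 ↥(maximalRealSubfield F))))
                    (IsCMField.complexConj_ne_one F) hJ hw (UnitaryGroup.isUnit_placeForm Jstar hJu w) (HeckeCharacter.uniformizer F w) 1 :
                  ↥(finAdelic ↥(maximalRealSubfield F) F (IsCMField.complexConj F) 2 Jstar)) K₁ Kc)
             (_hK₁ : (K₁.1.1 : Subgroup ↥(finAdelic ↥(maximalRealSubfield F) F (IsCMField.complexConj F) 2 Jstar))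
                = Kc.1.1 ⊓ (Kc.1.1).map (MulAut.conj
                    (UnitaryGroup.heckeElementAt ↥(maximalRealSubfield F) F (IsCMField.complexConj F) 2 Jstar
                      (⟨w, rfl⟩ : UnitaryGroup.PlacesOver F (w.under (𝓞 ↥(maximalRealSubfield F))))
                      (IsCMField.complexConj_ne_one F) hJ hw (UnitaryGroup.isUnit_placeForm Jstar hJu w) (HeckeCharacter.uniformizer F w) 1 :
                    ↥(finAdelic ↥(maximalRealSubfield F) F (IsCMField.complexConj F) 2 Jstar))).toMonoidHom)
             (ht₂ : C5.HeckeLE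
                (UnitaryGroup.heckeElementAt ↥(maximalRealSubfield F) F (IsCMField.complexConj F) 2 Jstar
                    (⟨w, rfl⟩ : UnitaryGroup.PlacesOver F (w.under (𝓞 ↥(maximalRealSubfield F))))
                    (IsCMField.complexConj_ne_one F) hJ hw (UnitaryGroup.isUnit_placeForm Jstar hJu w) (HeckeCharacter.uniformizer F w) 2 :
                  ↥(finAdelic ↥(maximalRealSubfield F) F (IsCMField.complexConj F) 2 Jstar)) Kc Kc),
           ∃ (𝒯 : IntegralModel (HeightOneSpectrum.valuationSubringAtPrime F w) F (S.M.obj K₁))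
             (_h𝒯 : AlgebraicGeometry.IsProper 𝒯.total.hom)
             (π₁ π₂ : 𝒯.total ⟶ 𝒮c.total)
             (_hflat : AlgebraicGeometry.Flat π₁.left) (_hlfp : AlgebraicGeometry.LocallyOfFinitePresentation π₁.left)
             (_hfin : AlgebraicGeometry.IsFinite π₁.left)
             (_hπ₁ : (genericFibre (HeightOneSpectrum.valuationSubringAtPrime F w) F).map π₁ ≫ 𝒮c.genericIso'.hom
                = 𝒯.genericIso'.hom ≫ S.M.map (homOfLE hle))
             (_hπ₂ : (genericFibre (HeightOneSpectrum.valuationSubringAtPrime F w) F).map π₂ ≫ 𝒮c.genericIso'.hom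
                = 𝒯.genericIso'.hom ≫ recordHeckeTranslateGS S hU7ₛ _ K₁ Kc ht)
             (s s' : AlgPoints 𝒮c.reductionAt (geomResidueField w) → AlgPoints 𝒯.reductionAt (geomResidueField w))
             (V : (𝒯.reductionAt).left.Opens)
             (_hV : AlgebraicGeometry.IsOpenImmersion (V.ι ≫ ((specialFibreFunctor w).map π₁).left)),
             haveI : AlgebraicGeometry.IsProper 𝒯.total.hom := _h𝒯
             (∀ (z : AlgPoints 𝒯.reductionAt (geomResidueField w)) (yb : AlgPoints 𝒮c.reductionAt (geomResidueField w)),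
                 AlgPoints.map ((specialFibreFunctor w).map π₁) z = yb → z = s yb ∨ z = s' yb) ∧
             (∀ yb : AlgPoints 𝒮c.reductionAt (geomResidueField w), AlgPoints.map ((specialFibreFunctor w).map π₁) (s yb) = yb) ∧
             (∀ yb : AlgPoints 𝒮c.reductionAt (geomResidueField w), AlgPoints.map ((specialFibreFunctor w).map π₁) (s' yb) = yb) ∧
             (∀ yb : AlgPoints 𝒮c.reductionAt (geomResidueField w),
                 s yb ≠ s' yb → (s yb).toSpecHom.base (closedPoint (geomResidueField w)) ∈ V) ∧
             (∀ yb : AlgPoints 𝒮c.reductionAt (geomResidueField w),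
                 AlgPoints.map ((specialFibreFunctor w).map π₂) (s yb) = AlgPoints.map (frobeniusOver 𝒮c.reductionAt) yb) ∧
             (∀ y : AlgPoints (S.M.obj Kc) (AlgebraicClosure (w.adicCompletion F)),
                 AlgPoints.map (frobeniusOver 𝒮c.reductionAt)
                     (AlgPoints.map ((specialFibreFunctor w).map π₂) (s' (𝒮c.geomReductionMap y)))
                   = 𝒮c.geomReductionMap (AlgPoints.map (recordHeckeTranslateGS S hU7ₛ _ Kc Kc ht₂) y))

/-- **LETTER MODv3 — `RecordCurveCongruenceOnPointsCofinal`** (ED. 5.3, F0P5a-plan (g4), 2026-08-31; the LIBERALISED, ROAD-NEUTRAL MOD boundary;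
HOME DESK ONLY until the human՚s P6 word — s392 (3) ∕ s422 (b) ∕ s430 (4)).  For every record datum and small level `K` there is a finite set
`S₃(K)` of places such that at every split place `w ∉ S₃(K)` with `J⋆_w ∈ GL₂(𝒪_w)` and `K` hyperspecial-factorisable at `w|_{F⁺}` MOD supplies:
(α) a smooth proper model `𝒮` of `M⋆_K` over `𝒪_{F,(w)}` (the pin of s396 (1)); (β′) a sublevel `Kc ≤ K`, again hyperspecial-factorisable at
`w|_{F⁺}` (print: `Kc = K ∩ K(𝔩^m)`, `𝔩 ∤ w`, making `Kc` neat), a smooth proper model `𝒮c` of `M⋆_{Kc}` and a model morphism `ū : 𝒮c ⟶ 𝒮` whose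
generic fibre is `u_{Kc→K}` (★ C2a square; MOD builds `𝒮 := 𝒮c ∕ (K∕Kc)`, ★ L6.6 `GeometricQuotientTameSmoothCurve`); (γ″) THE C3 IDENTITY ITSELF
at `(Kc, 𝒮c)`: for every deeper small level `N′ ≤ Kc`, coset families `r̃₁ r̃₂` of `Kc t₁ Kc ∕ Kc`, `Kc t₂ Kc ∕ Kc` and every `x′ ∈ M⋆_{N′}(Ω)`,
`{F red(T_{r̃₁ β} x′)}_β = {F² red(u x′)} + (N w)·{red(T_{r̃₂ β} x′)}_β` on `κ̄(w)`-points of `𝒮c` — token-for-token the block of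
`RecordCurveCongruenceOnPoints` under `(K, 𝒮, N, r₁, r₂, x) ↦ (Kc, 𝒮c, N′, r̃₁, r̃₂, x′)`, i.e. hypothesis (iii) `hC3t` of the DESCENT lemma
`ED5Desk.congruenceOnPoints_of_levelDescent` (CERT-ED5-Descent caae2901, A-p05 (g16)).  WHY THIS SHAPE: a moduli description of `M⋆` exists only
at NEAT level (representability), so EVERY road of P6 proves the congruence at some cofinal neat `Kc` and descends along the tame quotient; the
print-shape boundary MODv2 `RecordCurveCongruenceCorrespondenceCofinal` fixes in addition the MECHANISM of print (the correspondence `𝒯 = 𝓜_{K₁}`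
with its two sections, [Liu2021] D.8 (1)–(3)), MODv3 only its pointwise OUTPUT — a road that reads `T̄_𝔭` off the `N w + 1` finite flat subgroup
schemes of `𝒜_x[ϖ]_w` point by point (Road P″, memo `MOD-ROAD-Pprime.v0`) inhabits MODv3 without building `𝒯`, its flatness or the open `V`.
LOGIC: `MODv2 → Γ3-Q → DEG → FULL → MODv3` (`modv3_of_modv2`, the CORE half of the ED. 5.2 PEN at level `Kc`) and `MODv3 → DESC → letter_D8`
(`stub_C3_of_v3`, push-forward along `ū_v` + reindex); conversely `letter_D8 → MODv3` with `Kc := K`, `𝒮c := 𝒮`, `ū := 𝟙` — so MODv3 is the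
registered residual `stub_C3` up to the record descent (M, ★-inhabited `stub_desc`), asked for exactly where MOD can deliver it.  XL; discharged
only by the MOD programme P6.  NOT asserted here.
(print: Liu2021, Prop. D.8 (1)–(3) p. 135 and proof of Cor. D.9 p. 139 L4–L31) (print: Carayol1986Compositio, §§6.6–6.7, §9.4, Prop. 10.3)
(print: DiamondShurman2005, Thm. 8.7.2 p. 353) (print: Shimura1971, §7.4 (7.4.1)–(7.4.3)) (print: KatzMazur1985, Thm. 13.4.7) -/
def RecordCurveCongruenceOnPointsCofinal : Prop :=
  ∀ (F : Type) [Field F] [NumberField F] [IsCMField F] [IsGalois ℚ F] (ι₁ : F →+* ℂ)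
    (Jstar : Matrix (Fin 2) (Fin 2) F)
    (K₀ : C5.OpenCompactSubgroup ↥(finAdelic ↥(maximalRealSubfield F) F (IsCMField.complexConj F) 2 Jstar))
    (S : RecordSystemGS F Jstar ι₁ K₀) (hU7ₛ : S.HeckeTranslateDefinedOver)
    (hJ : (Jstar.map (IsCMField.complexConj F))ᵀ = Jstar) (hJu : IsUnit Jstar) (K : C5.SmallLevel K₀),
    ∃ S₃ : Set (HeightOneSpectrum (𝓞 F)), S₃.Finite ∧
      ∀ w : HeightOneSpectrum (𝓞 F), w ∉ S₃ → ∀ hw : (IsCMField.complexConj F) • w ≠ w,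
        (UnitaryGroup.isUnit_placeForm Jstar hJu w).unit ∈ glInt 2 (w.adicCompletion F) →
          UnitaryGroup.IsHyperspecialAt ↥(maximalRealSubfield F) F (IsCMField.complexConj F) 2 Jstar K.1.1
            (w.under (𝓞 ↥(maximalRealSubfield F))) →
          ∃ (𝒮 : IntegralModel (HeightOneSpectrum.valuationSubringAtPrime F w) F (S.M.obj K)) (_h𝒮 : 𝒮.IsSmoothProper 1)
            (Kc : C5.SmallLevel K₀) (hKcK : Kc ≤ K)
            (_hKc : UnitaryGroup.IsHyperspecialAt ↥(maximalRealSubfield F) F (IsCMField.complexConj F) 2 Jstar Kc.1.1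
               (w.under (𝓞 ↥(maximalRealSubfield F))))
            (𝒮c : IntegralModel (HeightOneSpectrum.valuationSubringAtPrime F w) F (S.M.obj Kc)) (h𝒮c : 𝒮c.IsSmoothProper 1)
            (ū : 𝒮c.total ⟶ 𝒮.total)
            (_hū : (genericFibre (HeightOneSpectrum.valuationSubringAtPrime F w) F).map ū ≫ 𝒮.genericIso'.hom
               = 𝒮c.genericIso'.hom ≫ S.M.map (homOfLE hKcK)),
           haveI : AlgebraicGeometry.IsProper 𝒮c.total.hom := h𝒮c.2
           ∀ (N' : C5.SmallLevel K₀) (hN'Kc : N' ≤ Kc)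
             (rc₁ : orbit (Kc.1.1 : Subgroup ↥(finAdelic ↥(maximalRealSubfield F) F (IsCMField.complexConj F) 2 Jstar))
                  ((UnitaryGroup.heckeElementAt ↥(maximalRealSubfield F) F (IsCMField.complexConj F) 2 Jstar
                      (⟨w, rfl⟩ : UnitaryGroup.PlacesOver F (w.under (𝓞 ↥(maximalRealSubfield F))))
                      (IsCMField.complexConj_ne_one F) hJ hw (UnitaryGroup.isUnit_placeForm Jstar hJu w) (HeckeCharacter.uniformizer F w) 1 :
                    ↥(finAdelic ↥(maximalRealSubfield F) F (IsCMField.complexConj F) 2 Jstar)) :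
                    ↥(finAdelic ↥(maximalRealSubfield F) F (IsCMField.complexConj F) 2 Jstar) ⧸
                      (Kc.1.1 : Subgroup ↥(finAdelic ↥(maximalRealSubfield F) F (IsCMField.complexConj F) 2 Jstar))) →
                ↥(finAdelic ↥(maximalRealSubfield F) F (IsCMField.complexConj F) 2 Jstar)),
             (∀ β, ((rc₁ β : ↥(finAdelic ↥(maximalRealSubfield F) F (IsCMField.complexConj F) 2 Jstar)) :
                 ↥(finAdelic ↥(maximalRealSubfield F) F (IsCMField.complexConj F) 2 Jstar) ⧸
                   (Kc.1.1 : Subgroup ↥(finAdelic ↥(maximalRealSubfield F) F (IsCMField.complexConj F) 2 Jstar))) = β.1) →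
             ∀ (hrcN₁ : ∀ β, C5.HeckeLE (rc₁ β) N' Kc)
               (rc₂ : orbit (Kc.1.1 : Subgroup ↥(finAdelic ↥(maximalRealSubfield F) F (IsCMField.complexConj F) 2 Jstar))
                  ((UnitaryGroup.heckeElementAt ↥(maximalRealSubfield F) F (IsCMField.complexConj F) 2 Jstar
                      (⟨w, rfl⟩ : UnitaryGroup.PlacesOver F (w.under (𝓞 ↥(maximalRealSubfield F))))
                      (IsCMField.complexConj_ne_one F) hJ hw (UnitaryGroup.isUnit_placeForm Jstar hJu w) (HeckeCharacter.uniformizer F w) 2 :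
                    ↥(finAdelic ↥(maximalRealSubfield F) F (IsCMField.complexConj F) 2 Jstar)) :
                    ↥(finAdelic ↥(maximalRealSubfield F) F (IsCMField.complexConj F) 2 Jstar) ⧸
                      (Kc.1.1 : Subgroup ↥(finAdelic ↥(maximalRealSubfield F) F (IsCMField.complexConj F) 2 Jstar))) →
                ↥(finAdelic ↥(maximalRealSubfield F) F (IsCMField.complexConj F) 2 Jstar)),
             (∀ β, ((rc₂ β : ↥(finAdelic ↥(maximalRealSubfield F) F (IsCMField.complexConj F) 2 Jstar)) :
                 ↥(finAdelic ↥(maximalRealSubfield F) F (IsCMField.complexConj F) 2 Jstar) ⧸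
                   (Kc.1.1 : Subgroup ↥(finAdelic ↥(maximalRealSubfield F) F (IsCMField.complexConj F) 2 Jstar))) = β.1) →
             ∀ (hrcN₂ : ∀ β, C5.HeckeLE (rc₂ β) N' Kc),
             ∀ x' : AlgPoints (S.M.obj N') (AlgebraicClosure (w.adicCompletion F)),
               ∑ᶠ β, ({AlgPoints.map (frobeniusOver 𝒮c.reductionAt)
                          (𝒮c.geomReductionMap (AlgPoints.map (recordHeckeTranslateGS S hU7ₛ (rc₁ β) N' Kc (hrcN₁ β)) x'))} :
                        Multiset (AlgPoints 𝒮c.reductionAt (geomResidueField w)))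
                 = {AlgPoints.map (frobeniusOver 𝒮c.reductionAt) (AlgPoints.map (frobeniusOver 𝒮c.reductionAt)
                       (𝒮c.geomReductionMap (AlgPoints.map (S.M.map (homOfLE hN'Kc)) x')))}
                   + ∑ᶠ β, Ideal.absNorm w.asIdeal •
                       ({𝒮c.geomReductionMap (AlgPoints.map (recordHeckeTranslateGS S hU7ₛ (rc₂ β) N' Kc (hrcN₂ β)) x')} :
                         Multiset (AlgPoints 𝒮c.reductionAt (geomResidueField w)))

end Edition5Desk
end Summit.HodgeConjecture.HodgeConjecture.Cruxes.HLiu418.F0D9opRoad2
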